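import Summits.BirchSwinnertonDyer.BirchSwinnertonDyer.Theorems.ResidualThetaTransportAtTwoRlfTwistedPlusLocShiftIncl
import Summits.BirchSwinnertonDyer.BirchSwinnertonDyer.Theorems.ResidualThetaTransportAtTwoRlfTwistedPlusLocShiftDatum
import HarnessLib

/-!
# Road T for item 23110, brick (R3) = (T2)⁺ part 2″: the twisted `±`-local LOC engine with ONE local target for all levels
# (`…PlusLocShiftIncl` fed by the Step-A datum of `…PlusLocShiftDatum`), and `p = 2` unconditionally

Route `ResidualThetaTransportAtTwo` (RTT, crux r201 `ResidualLambdaFormulaNegDiscAtTwo`, stmt-BirchSwinnertonDyer-23110) /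
`ThetaPartnerAtTwo` (TP2). Seat `prover-bsd-wall-tp2-p2x-w3` g12; `--supports stmt-BirchSwinnertonDyer-23110`. THEOREMS ONLY (no
definition, no named fact, no `sorry`); route-independent; closes nothing.

* `exists_twistedTorsion_localLift_kummer_of_coinvariantsDivTwisted_incl` — any `K`, `W`, `p`, `κ`, `E`, `g`, `u ≡ 1 (mod p)`,
  `A ≤ E(K_∞·E)` with the twisted divisibility (DIV_{A,u}): for every `t ∈ H¹(K_∞, E[p^∞])` with `u·conj_{g|} t − t` Kummer-from-`A`
  there are `J₀` and `x ∈ H¹(Γ_E, E[p^{J₀}](χ_u))` such that for every `J ≥ J₀` and every global `y ∈ H¹(Γ_K, E[p^J](χ_u))` with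
  `res_E y − H¹(ι) x ∈ W.twistedTorsionLocalKummer p κ J u hu E A` (the lead's (D1)): `t − twistedTorsionToH1 y` is Kummer-from-`A`
  (`exists_twistedShift_of_coinvariantsDivTwisted` + `exists_twistedTorsion_localLift_kummer_of_shift_incl`).
* `exists_twistedTorsion_localLift_plusKummer_two_incl` — `K = ℚ`, `p = 2`, `GoodSS`, `a₂ = 0`, cyclotomic `κ`, `v ∋ 2`,
  `A = ⋃ₙ E⁺(ℚ_{2,n})`: the same UNCONDITIONALLY ((DIV_{A,u}) is `plusCoinvariantsDivTwisted_two`, HONDA⁺@2).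

This is the (R3) input of the assembly «LIFT⁺₂(u) ⟸ H-PLUSDUAL(u) ∧ H-FIN(u)» (eventual Poitou–Tate lifting with one prescribed class at
the place above `2`). HONEST FRAMING: closes nothing; 23110 is NOT proved; BSD is not proved by any of this.
References: [GreenbergLNM1716] §4 Lemma 4.7 (pp. 107–108), p. 124; [BDKim2013] Props. 2.2–2.3; [Kobayashi2003] Def. 1.1, §8.4.
-/

set_option autoImplicit false
-- the Theorems namespace of this sub repeats the summit name by design (D-0017 nested layout)
set_option linter.dupNamespace false

noncomputable section

open scoped Classical NumberField

open NumberField IsDedekindDomain CategoryTheory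

universe u

namespace Summit.BirchSwinnertonDyer.BirchSwinnertonDyer.Theorems.SignedEC.TwistedLocalDescent

open Literature.NumberTheory.EllipticCurves Literature.NumberTheory.GaloisRepresentations
  WeierstrassCurve ZpExtension Literature.NumberTheory.EllipticCurves.Kobayashi2003
  Literature.NumberTheory.EllipticCurves.Sprung2012

section EngineIncl

variable {K : Type u} [Field K] [NumberField K] (W : WeierstrassCurve K) [W.IsElliptic] {p : ℕ} [Fact p.Prime]
  (κ : ZpExtension K p) (E : Type u) [Field E] [Algebra K E]

/-- **The twisted LOC engine, one local target for all levels.** (DIV_{A,u}) + «`u·conj_{g|} t − t` Kummer-from-`A`» ⟹ some `J₀` and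
`x ∈ H¹(Γ_E, E[p^{J₀}](χ_u))` such that for every `J ≥ J₀` and every global `y` with `res_E y − H¹(ι) x` in the (D1) local Kummer
condition, `t − twistedTorsionToH1 y` is Kummer-from-`A`. [cite: GreenbergLNM1716, §4 Lemma 4.7 (pp. 107–108), p. 124]
[cite: BDKim2013, Props. 2.2–2.3] -/
theorem exists_twistedTorsion_localLift_kummer_of_coinvariantsDivTwisted_incl
    (A : AddSubgroup (localPoints W E))
    (hAM : A ≤ localTowerPointsOfEmb κ (closureEmb (K := K) E) W)
    {g : Field.absoluteGaloisGroup E} (hg : κ.IsTopGenerator (resGal (K := K) E g))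
    {u : ℤ} (hu : (p : ℤ) ∣ u - 1)
    (hdiv : ∀ x ∈ A, ∀ k : ℕ, ∃ y ∈ A, ∃ j : ℕ, ∃ w ∈ localTowerPointsOfEmb κ (closureEmb (K := K) E) W,
      p ^ j • x - p ^ k • (u • g • y - y) = p ^ (j + k) • w)
    (t : W.subgroupH1 p κ.kerSubgroup)
    (ht : u • W.conjH1 p κ.kerSubgroup (resGal (K := K) E g) t - t ∈
      localKummerOverOfEmb W p κ.kerSubgroup (closureEmb (K := K) E) A) :
    ∃ (J₀ : ℕ) (x : galoisCohomology ((W.twistedTorsionGaloisModule p κ J₀ u hu).restrictField E) 1),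
      ∀ (J : ℕ) (hJ : J₀ ≤ J) (y : galoisCohomology (W.twistedTorsionGaloisModule p κ J u hu) 1),
        galoisCohomology.res (W.twistedTorsionGaloisModule p κ J u hu) E 1 y -
            galoisCohomology.map ((W.twistedTorsionIncl p κ hJ u hu).restrictField E) 1 x ∈
          W.twistedTorsionLocalKummer p κ J u hu E A →
        t - W.twistedTorsionToH1 p κ J u hu y ∈ localKummerOverOfEmb W p κ.kerSubgroup (closureEmb (K := K) E) A := by
  obtain ⟨φ, S, T, hφt, hSA, hTt, hshift⟩ :=
    exists_twistedShift_of_coinvariantsDivTwisted W κ E A hdiv t ht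
  subst hφt
  exact exists_twistedTorsion_localLift_kummer_of_shift_incl W κ E A hAM hg hu φ S T hSA hTt hshift

end EngineIncl

section TwoIncl

variable (W : WeierstrassCurve ℚ) [W.IsElliptic] [W.IsGloballyMinimal] (κ : ZpExtension ℚ 2)

/-- **(R3) = (T2)⁺ at `p = 2`, one local target for all levels, unconditionally** (`GoodSS W 2`, `a₂ = 0`, cyclotomic `κ`, `v ∋ 2`,
`g` restricting to the topological generator, `u` odd, `A = ⋃ₙ E⁺(ℚ_{2,n})`; (DIV_{A,u}) is `plusCoinvariantsDivTwisted_two`).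
[cite: GreenbergLNM1716, §4 Lemma 4.7 (pp. 107–108), p. 124] [cite: BDKim2013, Props. 2.2–2.3] [cite: Kobayashi2003, §8.4] -/
theorem exists_twistedTorsion_localLift_plusKummer_two_incl (hss : Rank1Residual.GoodSS W 2) (ha : W.frobeniusTrace 2 = 0)
    (hκ : κ.IsCyclotomic) (v : HeightOneSpectrum (𝓞 ℚ)) (hv : (2 : 𝓞 ℚ) ∈ v.asIdeal)
    {g : Field.absoluteGaloisGroup (v.adicCompletion ℚ)} (hg : κ.IsTopGenerator (resGal (K := ℚ) (v.adicCompletion ℚ) g))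
    {u : ℤ} (hu : ((2 : ℕ) : ℤ) ∣ u - 1) (t : W.subgroupH1 2 κ.kerSubgroup)
    (ht : u • W.conjH1 2 κ.kerSubgroup (resGal (K := ℚ) (v.adicCompletion ℚ) g) t - t ∈
      localKummerOverOfEmb W 2 κ.kerSubgroup (closureEmb (K := ℚ) (v.adicCompletion ℚ))
        (⨆ n, signedLocalPoints κ (v.adicCompletion ℚ) W 1 n)) :
    ∃ (J₀ : ℕ) (x : galoisCohomology ((W.twistedTorsionGaloisModule 2 κ J₀ u hu).restrictField (v.adicCompletion ℚ)) 1),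
      ∀ (J : ℕ) (hJ : J₀ ≤ J) (y : galoisCohomology (W.twistedTorsionGaloisModule 2 κ J u hu) 1),
        galoisCohomology.res (W.twistedTorsionGaloisModule 2 κ J u hu) (v.adicCompletion ℚ) 1 y -
            galoisCohomology.map ((W.twistedTorsionIncl 2 κ hJ u hu).restrictField (v.adicCompletion ℚ)) 1 x ∈
          W.twistedTorsionLocalKummer 2 κ J u hu (v.adicCompletion ℚ) (⨆ n, signedLocalPoints κ (v.adicCompletion ℚ) W 1 n) →
        t - W.twistedTorsionToH1 2 κ J u hu y ∈
          localKummerOverOfEmb W 2 κ.kerSubgroup (closureEmb (K := ℚ) (v.adicCompletion ℚ))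
            (⨆ n, signedLocalPoints κ (v.adicCompletion ℚ) W 1 n) := by
  have hAM := iSup_signedLocalPointsOfEmb_le_localTowerPointsOfEmb W κ 1 (closureEmb (K := ℚ) (v.adicCompletion ℚ))
  have hg' : κ.IsTopGenerator (resGalOfEmb (closureEmb (K := ℚ) (v.adicCompletion ℚ)) g) := hg
  have hDIV := plusCoinvariantsDivTwisted_two W hss ha hκ v hv hg' (by exact_mod_cast hu)
  refine exists_twistedTorsion_localLift_kummer_of_coinvariantsDivTwisted_incl W κ (v.adicCompletion ℚ)
    (⨆ n, signedLocalPoints κ (v.adicCompletion ℚ) W 1 n) hAM hg hu ?_ t ht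
  intro x hx k
  obtain ⟨y, hy, w, hw, h⟩ := hDIV x hx k
  exact ⟨y, hy, k, w, hAM hw, h⟩

end TwoIncl

end Summit.BirchSwinnertonDyer.BirchSwinnertonDyer.Theorems.SignedEC.TwistedLocalDescent

end
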